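import Summits.CriticalPhenomena.PercolationContinuityZ3.Theorems.Transplant.SkelSeedSlabDeepKit
import Summits.CriticalPhenomena.PercolationContinuityZ3.Theorems.Transplant.SkelStepIVInputs
import Summits.CriticalPhenomena.PercolationContinuityZ3.Theorems.Transplant.SkelCubeAt
import Summits.CriticalPhenomena.PercolationContinuityZ3.Theorems.Transplant.SkelRimDeep
import Summits.CriticalPhenomena.PercolationContinuityZ3.Theorems.Transplant.SkelRoom
import HarnessLib

/-!
# L5.15 of the general node (`HOME/SHEAR-SCOPE.md` §3.9; p3-g4 allocation 2026-08-20T20:38:07Z (3)), part 1 — the PER-CONTACT DICHOTOMY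
# `hcon` of the generic kit clause (p1-g7's `SkelI.kitClause`, L5.9) for a window step whose enlarged target is a TRUE target plus a RIM
# (the window-level vertices beyond depth `Rt − L''` from the centre): generic twin of `BoxProdZ2ConcKits.hcon_tube₂` / `hcon_of_roomQ₂`

builds on p205010 (kernel theorem, internal audit signed; external expert review pending) — nothing in this file uses p205010.
Lane `prim-bschramm`, typed by the `prim-hp-8` lineage (gen 24); helper file (`--supports stmt-CriticalPhenomena-4575 --as helper`).
NEW FILE over `SkelSeedSlabDeepKit` (p1-g7: `slabGeomDeep`, `NearFaceOKDeep`, `deepCtr`, `exitDir`), `SkelCubeAt` (p3-g4: `cubeCtr`, `cubeFace`),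
`SkelStepIVInputs` (p3-g4: `Skel.hcon_of_straight`), `SkelRimDeep` (p3-g4: `Skel.deep_or_far`), `SkelRoom` (p3-g4).  Binder form (`[DecidableEq V]`).

Contacts `x` of the window level `B⟨j⟩` (exploration graph `winGraph G w₀ R`) come in three kinds: FAR (`y x ∉ B_G(w₀, R − r₀)`, face
`{y x}`), NEAR-RIM (near, but the cube centre `c x` is not deep: `B_G(c x, Ldeep) ⊄ B_G(w₀, Rt)`; then the whole cube face lies beyond depth
`Rt − L''` once `Ldeep + ψ M ≤ L'' ≤ Rt`) and DEEP.  If the target contains every level vertex beyond depth `Rt − L''` (`hTrim`) and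
`Rt − L'' ≤ R − r₀`, the first two kinds take the face-in-target branch of `hcon`; the deep kind takes the route branch: an abstract route
hypothesis under deepness (the face step's elongated inner route, hp-8's `SkelConcFaceRoute`) — `hcon_win₂` — or a straight quarter-face route
from planar room (`Skel.hcon_of_straight`) — `hcon_win₂_of_room` (corridor / root / inner steps).
* §1 `macroPiece_faceElt_nonempty`, `cubeFace_nonempty` (a step walk of length `M` inside the cylinder);
* §2 **`hcon_win₂`**; §3 **`hcon_win₂_of_room`**.
[cite: KozmaNitzan2024, §4 Lemma 10 Steps III–IV (pp. 19–21), Lemma 11 (p. 22), Lemma 12 (p. 24: edge faces)]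
-/

noncomputable section

open MeasureTheory
open scoped Classical

namespace Summit.CriticalPhenomena.PercolationContinuityZ3.Theorems

namespace Transplant

namespace SkelI

open Literature.Probability.Percolation Literature.Probability.LatticeModels SimpleGraph KNLevels KozmaNitzan
open Literature.Probability.Percolation.GM (HOct sp piece faceFin facePiece)
open Literature.Probability.Percolation.KozmaNitzan.Cells (oth oth_ne eq_oth_of_ne oth_oth)
open Literature.Barriers.CriticalPhenomena (graphBall graphBall_finite mem_graphBall_self graphBall_mono)
open Skel (winGraph winGraph_adj winGraph_le winLevel mem_winLevel_iff winLData winLData_X inNbr KitGeom fatSeq macroPiece fatRadius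
  cubeCtr cubeFace faceElt mem_fatSeq_iff cubeFace_subset_fatSeq mem_graphBall_of_mem_fatSeq)

variable {V : Type} [DecidableEq V] {G : SimpleGraph V} [G.LocallyFinite] (Φ : PlanarSkeletonConc G)

/-! ## §1 Faces are nonempty -/

omit [DecidableEq V] in
/-- The straight `step` walk from `c` in direction `σ e_i` stays in the cylinder ball: `walk i σ c k ∈ cylBall c n k` for `k ≤ n`. [folklore] -/
theorem walk_mem_cylBall (c : V) (i : Fin 2) (σ : ℤˣ) {n k : ℕ} (hk : k ≤ n) : walk Φ i σ c k ∈ Φ.cylBall c n k := by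
  induction k with
  | zero => simpa [walk] using Skel.self_mem_cylBall Φ c n 0
  | succ k ih =>
    have hk' : k ≤ n := by omega
    refine Skel.mem_cylBall_succ_of_adj Φ c le_rfl (ih hk') (walk_adj Φ i σ c k) ?_
    rw [PlanarSkeleton.mem_cyl, φ_walk, add_sub_cancel_left, mem_box]
    intro i'
    by_cases hi : i' = i
    · subst hi; rcases Int.units_eq_one_or σ with h | h <;> simp [h] <;> omega
    · simp [hi]

omit [DecidableEq V] in
/-- **The `(i, σ)`-quarter-piece of scale `M` and radius `R ≥ M` about any centre is nonempty** (the endpoint of the straight walk of length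
`M` in direction `σ e_i`). [folklore] -/
theorem macroPiece_faceElt_nonempty (c : V) {M R : ℕ} (hMR : M ≤ R) (i : Fin 2) (σ : ℤˣ) : (macroPiece Φ c M R (faceElt i σ)).Nonempty := by
  refine ⟨walk Φ i σ c M, ?_⟩
  rw [Skel.macroPiece, Finset.mem_filter, Skel.mem_cylBallFin]
  refine ⟨Skel.cylBall_mono Φ c le_rfl hMR (walk_mem_cylBall Φ c i σ le_rfl), ?_⟩
  rw [Skel.sp_faceElt_mem_facePiece_iff, φ_walk, add_sub_cancel_left]
  refine ⟨by simp [mul_comm], by simp [oth_ne], by simp [oth_ne]⟩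

omit [DecidableEq V] in
/-- **Cube faces are nonempty** (`M ≤ ψ M`). [folklore] -/
theorem cubeFace_nonempty [Countable V] {p : unitInterval} (hC : Φ.toPlanarSkeleton.CylSubcritical p) (t : V) (i : Fin 2) (σ : ℤˣ)
    (ℓs M : ℕ) : (cubeFace Φ hC t i σ ℓs M).Nonempty :=
  macroPiece_faceElt_nonempty Φ _ (Skel.le_fatRadius Φ hC M) i σ

/-! ## §2 The dichotomy with an abstract deep route -/

section Dichotomy

variable [Countable V] {p : unitInterval} (hC : Φ.toPlanarSkeleton.CylSubcritical p) {msel : V → ℕ} {Ssc : Finset ℕ} {q : unitInterval}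
  {δ : ℝ} {M : ℕ} {w₀ : V} {R : ℕ} {lo hi : Site 2} {j ℓs R' r₀ rs cU : ℕ} {Wt : Sym2 V → unitInterval} {D T : Finset V}
  {Rt L'' Ldeep : ℕ} {Unear : V → Finset V}

/-- **The per-contact dichotomy `hcon` of `SkelI.kitClause` for a window step with true target + rim, deep contacts by an abstract ROUTE
hypothesis under deepness.**  Hypotheses: the near face map `Unear` IS the cube face at near contacts (`hUdef`, as in `kitClause`) and satisfies the near-face
conditions (`NearFaceOKDeep`, e.g. p3-g4's `nearFaceOK_cube`) for `U x ⊆ B⟨j⟩`; every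
level vertex beyond depth `Rt − L''` is in the target (`hTrim`); far contacts are rim contacts (`Rt − L'' ≤ R − r₀`); the deepness radius and
the cube reach fit in the rim width (`Ldeep + ψ M ≤ L'' ≤ Rt`); and for DEEP near contacts (`B_G(c x, Ldeep) ⊆ B_G(w₀, Rt)`) the route clause.
[cite: KozmaNitzan2024, §4 Lemma 10 Step IV (pp. 19–21), Lemma 11 (p. 22), Lemma 12 (p. 24)] -/
theorem hcon_win₂ (hUdef : ∀ x ∈ outerBoundary (winGraph G w₀ R) (winLevel Φ w₀ R lo hi j),
      (inNbr Φ w₀ R (Finset.Icc (lo - (j : Site 2)) (hi + (j : Site 2))) x) ∈ graphBall G w₀ (R - r₀) →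
      Unear x = (cubeFace Φ hC (deepCtr Φ w₀ R (lo - (j : Site 2)) (hi + (j : Site 2)) ℓs M x) (exitDir Φ w₀ R (lo - (j : Site 2)) (hi + (j : Site 2)) x).1 (exitDir Φ w₀ R (lo - (j : Site 2)) (hi + (j : Site 2)) x).2 ℓs M))
    (hU : NearFaceOKDeep Φ w₀ R lo hi j ℓs M R' r₀ rs cU Unear)
    (hTrim : ∀ v ∈ winLevel Φ w₀ R lo hi j, v ∉ graphBall G w₀ (Rt - L'') → v ∈ T) (hRL : Rt - L'' ≤ R - r₀)
    (hL : Ldeep + fatRadius Φ hC M ≤ L'') (hLR : L'' ≤ Rt)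
    (hroute : ∀ x ∈ outerBoundary (winGraph G w₀ R) (winLevel Φ w₀ R lo hi j),
      (inNbr Φ w₀ R (Finset.Icc (lo - (j : Site 2)) (hi + (j : Site 2))) x) ∈ graphBall G w₀ (R - r₀) →
      graphBall G (cubeCtr Φ (deepCtr Φ w₀ R (lo - (j : Site 2)) (hi + (j : Site 2)) ℓs M x) (exitDir Φ w₀ R (lo - (j : Site 2)) (hi + (j : Site 2)) x).1 (exitDir Φ w₀ R (lo - (j : Site 2)) (hi + (j : Site 2)) x).2 ℓs M) Ldeep ⊆ graphBall G w₀ Rt →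
      ∀ t ∈ Φ.types,
        (∀ M' ∈ Ssc, 1 - δ ^ 2 < (bondPercolation G q).real (UniqZone.zone G (fatSeq Φ hC (cubeCtr Φ (deepCtr Φ w₀ R (lo - (j : Site 2)) (hi + (j : Site 2)) ℓs M x) (exitDir Φ w₀ R (lo - (j : Site 2)) (hi + (j : Site 2)) x).1 (exitDir Φ w₀ R (lo - (j : Site 2)) (hi + (j : Site 2)) x).2 ℓs M)) (msel t) M') ∧
          ∀ g' : HOct 2, 1 - δ ^ 2 < (bondPercolation G q).real
            (linkIn (↑(fatSeq Φ hC (cubeCtr Φ (deepCtr Φ w₀ R (lo - (j : Site 2)) (hi + (j : Site 2)) ℓs M x) (exitDir Φ w₀ R (lo - (j : Site 2)) (hi + (j : Site 2)) x).1 (exitDir Φ w₀ R (lo - (j : Site 2)) (hi + (j : Site 2)) x).2 ℓs M) M')) (fatSeq Φ hC (cubeCtr Φ (deepCtr Φ w₀ R (lo - (j : Site 2)) (hi + (j : Site 2)) ℓs M x) (exitDir Φ w₀ R (lo - (j : Site 2)) (hi + (j : Site 2)) x).1 (exitDir Φ w₀ R (lo - (j : Site 2)) (hi + (j : Site 2))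 x).2 ℓs M) (msel t)) (macroPiece Φ (cubeCtr Φ (deepCtr Φ w₀ R (lo - (j : Site 2)) (hi + (j : Site 2)) ℓs M x) (exitDir Φ w₀ R (lo - (j : Site 2)) (hi + (j : Site 2)) x).1 (exitDir Φ w₀ R (lo - (j : Site 2)) (hi + (j : Site 2)) x).2 ℓs M) M' (fatRadius Φ hC M') g'))) →
        ∃ Qt Ft : Finset V, Ft ⊆ T ∧ Qt ⊆ D ∧ (∀ u ∈ Qt, ∀ v ∈ Qt, G.Adj u v → (winGraph G w₀ R).Adj u v) ∧
          Disjoint Ft (fatSeq Φ hC (cubeCtr Φ (deepCtr Φ w₀ R (lo - (j : Site 2)) (hi + (j : Site 2)) ℓs M x) (exitDir Φ w₀ R (lo - (j : Site 2)) (hi + (j : Site 2)) x).1 (exitDir Φ w₀ R (lo - (j : Site 2)) (hi + (j : Site 2)) x).2 ℓs M) M) ∧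
          1 - δ ^ 2 < (prodBernoulli Wt).real (linkIn (↑Qt) (fatSeq Φ hC (cubeCtr Φ (deepCtr Φ w₀ R (lo - (j : Site 2)) (hi + (j : Site 2)) ℓs M x) (exitDir Φ w₀ R (lo - (j : Site 2)) (hi + (j : Site 2)) x).1 (exitDir Φ w₀ R (lo - (j : Site 2)) (hi + (j : Site 2)) x).2 ℓs M) (msel t)) Ft)) :
    ∀ x ∈ outerBoundary (winGraph G w₀ R) (winLevel Φ w₀ R lo hi j),
      (∃ u ∈ (slabGeomDeep Φ w₀ R lo hi j ℓs M R' r₀ Unear).U x, u ∈ T) ∨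
      ((inNbr Φ w₀ R (Finset.Icc (lo - (j : Site 2)) (hi + (j : Site 2))) x) ∈ graphBall G w₀ (R - r₀) ∧ ∀ t ∈ Φ.types,
        (∀ M' ∈ Ssc, 1 - δ ^ 2 < (bondPercolation G q).real (UniqZone.zone G (fatSeq Φ hC (cubeCtr Φ (deepCtr Φ w₀ R (lo - (j : Site 2)) (hi + (j : Site 2)) ℓs M x) (exitDir Φ w₀ R (lo - (j : Site 2)) (hi + (j : Site 2)) x).1 (exitDir Φ w₀ R (lo - (j : Site 2)) (hi + (j : Site 2)) x).2 ℓs M)) (msel t) M') ∧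
          ∀ g' : HOct 2, 1 - δ ^ 2 < (bondPercolation G q).real
            (linkIn (↑(fatSeq Φ hC (cubeCtr Φ (deepCtr Φ w₀ R (lo - (j : Site 2)) (hi + (j : Site 2)) ℓs M x) (exitDir Φ w₀ R (lo - (j : Site 2)) (hi + (j : Site 2)) x).1 (exitDir Φ w₀ R (lo - (j : Site 2)) (hi + (j : Site 2)) x).2 ℓs M) M')) (fatSeq Φ hC (cubeCtr Φ (deepCtr Φ w₀ R (lo - (j : Site 2)) (hi + (j : Site 2)) ℓs M x) (exitDir Φ w₀ R (lo - (j : Site 2)) (hi + (j : Site 2)) x).1 (exitDir Φ w₀ R (lo - (j : Site 2)) (hi + (j : Site 2)) x).2 ℓs M) (msel t)) (macroPiece Φ (cubeCtr Φ (deepCtr Φ w₀ R (lo - (j : Site 2)) (hi + (j : Site 2)) ℓs M x) (exitDir Φ w₀ R (lo - (j : Site 2)) (hi + (j : Site 2)) x).1 (exitDir Φ w₀ R (lo - (j : Site 2)) (hi + (j : Site 2)) x).2 ℓs M) M' (fatRadius Φ hC M') g'))) →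
        ∃ Qt Ft : Finset V, Ft ⊆ T ∧ Qt ⊆ D ∧ (∀ u ∈ Qt, ∀ v ∈ Qt, G.Adj u v → (winGraph G w₀ R).Adj u v) ∧
          Disjoint Ft (fatSeq Φ hC (cubeCtr Φ (deepCtr Φ w₀ R (lo - (j : Site 2)) (hi + (j : Site 2)) ℓs M x) (exitDir Φ w₀ R (lo - (j : Site 2)) (hi + (j : Site 2)) x).1 (exitDir Φ w₀ R (lo - (j : Site 2)) (hi + (j : Site 2)) x).2 ℓs M) M) ∧
          1 - δ ^ 2 < (prodBernoulli Wt).real (linkIn (↑Qt) (fatSeq Φ hC (cubeCtr Φ (deepCtr Φ w₀ R (lo - (j : Site 2)) (hi + (j : Site 2)) ℓs M x) (exitDir Φ w₀ R (lo - (j : Site 2)) (hi + (j : Site 2)) x).1 (exitDir Φ w₀ R (lo - (j : Site 2)) (hi + (j : Site 2)) x).2 ℓs M) (msel t)) Ft)) := by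
  intro x hx
  by_cases hnear : (inNbr Φ w₀ R (Finset.Icc (lo - (j : Site 2)) (hi + (j : Site 2))) x) ∈ graphBall G w₀ (R - r₀)
  · by_cases hdeep : graphBall G (cubeCtr Φ (deepCtr Φ w₀ R (lo - (j : Site 2)) (hi + (j : Site 2)) ℓs M x) (exitDir Φ w₀ R (lo - (j : Site 2)) (hi + (j : Site 2)) x).1 (exitDir Φ w₀ R (lo - (j : Site 2)) (hi + (j : Site 2)) x).2 ℓs M) Ldeep ⊆ graphBall G w₀ Rt
    · exact Or.inr ⟨hnear, fun t ht hin => hroute x hx hnear hdeep t ht hin⟩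
    · -- near but not deep: the whole cube face lies in the rim
      left
      obtain ⟨u, hu⟩ := cubeFace_nonempty Φ hC (deepCtr Φ w₀ R (lo - (j : Site 2)) (hi + (j : Site 2)) ℓs M x) (exitDir Φ w₀ R (lo - (j : Site 2)) (hi + (j : Site 2)) x).1 (exitDir Φ w₀ R (lo - (j : Site 2)) (hi + (j : Site 2)) x).2 ℓs M
      have hUx : (slabGeomDeep Φ w₀ R lo hi j ℓs M R' r₀ Unear).U x = Unear x := by
        simp only [slabGeomDeep, if_pos hnear]
      have hu' : u ∈ Unear x := by rw [hUdef x hx hnear]; exact hu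
      refine ⟨u, by rw [hUx]; exact hu', hTrim u (hU.sub x hx hnear hu') fun hub => ?_⟩
      rcases Skel.deep_or_far G (cubeCtr Φ (deepCtr Φ w₀ R (lo - (j : Site 2)) (hi + (j : Site 2)) ℓs M x) (exitDir Φ w₀ R (lo - (j : Site 2)) (hi + (j : Site 2)) x).1 (exitDir Φ w₀ R (lo - (j : Site 2)) (hi + (j : Site 2)) x).2 ℓs M) hL hLR with h | h
      · exact hdeep h
      · exact Set.disjoint_left.1 h (mem_graphBall_of_mem_fatSeq Φ hC (cubeFace_subset_fatSeq Φ hC _ _ _ _ _ hu)) hub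
  · -- far contact: its inner neighbour is a rim vertex
    left
    have hy := inNbr_spec Φ (P := Finset.Icc (lo - (j : Site 2)) (hi + (j : Site 2))) hx
    have hUx : (slabGeomDeep Φ w₀ R lo hi j ℓs M R' r₀ Unear).U x = {(inNbr Φ w₀ R (Finset.Icc (lo - (j : Site 2)) (hi + (j : Site 2))) x)} := by
      simp only [slabGeomDeep, if_neg hnear]
    refine ⟨(inNbr Φ w₀ R (Finset.Icc (lo - (j : Site 2)) (hi + (j : Site 2))) x), by rw [hUx]; exact Finset.mem_singleton_self _, hTrim _ ?_ fun hyb => hnear (graphBall_mono G w₀ hRL hyb)⟩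
    rw [mem_winLevel_iff]
    exact ⟨hy.2.1, hy.2.2⟩

/-! ## §3 The dichotomy with straight routes from planar room -/

/-- **The per-contact dichotomy `hcon` for a window step with true target + rim and STRAIGHT deep routes** (corridor / root / inner steps):
for every near contact a route scale `ℓ ∈ Ssc`, `M < ℓ`, `ψ ℓ ≤ Ldeep`, with the planar square `φ(c x) + Λ_ℓ` inside `Dpl` and a quarter face
`φ(c x) + F_{a,τ}(ℓ)` inside `Tpl` (`hroom`), where `D ⊇ Win w₀ Dpl R` and `T ⊇ Win w₀ Tpl Rt`. [cite: KozmaNitzan2024, §4 Lemma 10 Step IV (p. 20), Lemma 11 (p. 23)] -/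
theorem hcon_win₂_of_room (hUdef : ∀ x ∈ outerBoundary (winGraph G w₀ R) (winLevel Φ w₀ R lo hi j),
      (inNbr Φ w₀ R (Finset.Icc (lo - (j : Site 2)) (hi + (j : Site 2))) x) ∈ graphBall G w₀ (R - r₀) →
      Unear x = (cubeFace Φ hC (deepCtr Φ w₀ R (lo - (j : Site 2)) (hi + (j : Site 2)) ℓs M x) (exitDir Φ w₀ R (lo - (j : Site 2)) (hi + (j : Site 2)) x).1 (exitDir Φ w₀ R (lo - (j : Site 2)) (hi + (j : Site 2)) x).2 ℓs M))
    (hU : NearFaceOKDeep Φ w₀ R lo hi j ℓs M R' r₀ rs cU Unear)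
    (hTrim : ∀ v ∈ winLevel Φ w₀ R lo hi j, v ∉ graphBall G w₀ (Rt - L'') → v ∈ T) (hRL : Rt - L'' ≤ R - r₀)
    (hL : Ldeep + fatRadius Φ hC M ≤ L'') (hLR : L'' ≤ Rt) (hRtR : Rt ≤ R)
    (hWD : IsSubbox (winGraph G w₀ R) Wt q D) {Dpl Tpl : Finset (Site 2)} (hDpl : Φ.Win w₀ Dpl R ⊆ D) (hTpl : Φ.Win w₀ Tpl Rt ⊆ T)
    (hroom : ∀ x ∈ outerBoundary (winGraph G w₀ R) (winLevel Φ w₀ R lo hi j),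
      (inNbr Φ w₀ R (Finset.Icc (lo - (j : Site 2)) (hi + (j : Site 2))) x) ∈ graphBall G w₀ (R - r₀) →
      ∃ ℓ ∈ Ssc, M < ℓ ∧ fatRadius Φ hC ℓ ≤ Ldeep ∧
        (∀ z : Site 2, z - Φ.φ (cubeCtr Φ (deepCtr Φ w₀ R (lo - (j : Site 2)) (hi + (j : Site 2)) ℓs M x) (exitDir Φ w₀ R (lo - (j : Site 2)) (hi + (j : Site 2)) x).1 (exitDir Φ w₀ R (lo - (j : Site 2)) (hi + (j : Site 2)) x).2 ℓs M) ∈ box 2 ℓ → z ∈ Dpl) ∧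
        ∃ (a : Fin 2) (τ : ℤˣ), ∀ z : Site 2, z a = Φ.φ (cubeCtr Φ (deepCtr Φ w₀ R (lo - (j : Site 2)) (hi + (j : Site 2)) ℓs M x) (exitDir Φ w₀ R (lo - (j : Site 2)) (hi + (j : Site 2)) x).1 (exitDir Φ w₀ R (lo - (j : Site 2)) (hi + (j : Site 2)) x).2 ℓs M) a + (τ : ℤ) * ℓ →
          Φ.φ (cubeCtr Φ (deepCtr Φ w₀ R (lo - (j : Site 2)) (hi + (j : Site 2)) ℓs M x) (exitDir Φ w₀ R (lo - (j : Site 2)) (hi + (j : Site 2)) x).1 (exitDir Φ w₀ R (lo - (j : Site 2)) (hi + (j : Site 2)) x).2 ℓs M) (oth a) ≤ z (oth a) → z (oth a) ≤ Φ.φ (cubeCtr Φ (deepCtr Φ w₀ R (lo - (j : Site 2)) (hi + (j : Site 2)) ℓs M x) (exitDir Φ w₀ R (lo - (j : Site 2)) (hi + (j : Site 2)) x).1 (exitDir Φ w₀ R (lo - (j : Site 2)) (hi + (j : Site 2)) x).2 ℓs M) (oth a) + ℓ → z ∈ Tpl) :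
    ∀ x ∈ outerBoundary (winGraph G w₀ R) (winLevel Φ w₀ R lo hi j),
      (∃ u ∈ (slabGeomDeep Φ w₀ R lo hi j ℓs M R' r₀ Unear).U x, u ∈ T) ∨
      ((inNbr Φ w₀ R (Finset.Icc (lo - (j : Site 2)) (hi + (j : Site 2))) x) ∈ graphBall G w₀ (R - r₀) ∧ ∀ t ∈ Φ.types,
        (∀ M' ∈ Ssc, 1 - δ ^ 2 < (bondPercolation G q).real (UniqZone.zone G (fatSeq Φ hC (cubeCtr Φ (deepCtr Φ w₀ R (lo - (j : Site 2)) (hi + (j : Site 2)) ℓs M x) (exitDir Φ w₀ R (lo - (j : Site 2)) (hi + (j : Site 2)) x).1 (exitDir Φ w₀ R (lo - (j : Site 2)) (hi + (j : Site 2)) x).2 ℓs M)) (msel t) M') ∧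
          ∀ g' : HOct 2, 1 - δ ^ 2 < (bondPercolation G q).real
            (linkIn (↑(fatSeq Φ hC (cubeCtr Φ (deepCtr Φ w₀ R (lo - (j : Site 2)) (hi + (j : Site 2)) ℓs M x) (exitDir Φ w₀ R (lo - (j : Site 2)) (hi + (j : Site 2)) x).1 (exitDir Φ w₀ R (lo - (j : Site 2)) (hi + (j : Site 2)) x).2 ℓs M) M')) (fatSeq Φ hC (cubeCtr Φ (deepCtr Φ w₀ R (lo - (j : Site 2)) (hi + (j : Site 2)) ℓs M x) (exitDir Φ w₀ R (lo - (j : Site 2)) (hi + (j : Site 2)) x).1 (exitDir Φ w₀ R (lo - (j : Site 2)) (hi + (j : Site 2)) x).2 ℓs M) (msel t)) (macroPiece Φ (cubeCtr Φ (deepCtr Φ w₀ R (lo - (j : Site 2)) (hi + (j : Site 2)) ℓs M x) (exitDir Φ w₀ R (lo - (j : Site 2)) (hi + (j : Site 2)) x).1 (exitDir Φ w₀ R (lo - (j : Site 2)) (hi + (j : Site 2)) x).2 ℓs M) M' (fatRadius Φ hC M') g'))) →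
        ∃ Qt Ft : Finset V, Ft ⊆ T ∧ Qt ⊆ D ∧ (∀ u ∈ Qt, ∀ v ∈ Qt, G.Adj u v → (winGraph G w₀ R).Adj u v) ∧
          Disjoint Ft (fatSeq Φ hC (cubeCtr Φ (deepCtr Φ w₀ R (lo - (j : Site 2)) (hi + (j : Site 2)) ℓs M x) (exitDir Φ w₀ R (lo - (j : Site 2)) (hi + (j : Site 2)) x).1 (exitDir Φ w₀ R (lo - (j : Site 2)) (hi + (j : Site 2)) x).2 ℓs M) M) ∧
          1 - δ ^ 2 < (prodBernoulli Wt).real (linkIn (↑Qt) (fatSeq Φ hC (cubeCtr Φ (deepCtr Φ w₀ R (lo - (j : Site 2)) (hi + (j : Site 2)) ℓs M x) (exitDir Φ w₀ R (lo - (j : Site 2)) (hi + (j : Site 2)) x).1 (exitDir Φ w₀ R (lo - (j : Site 2)) (hi + (j : Site 2)) x).2 ℓs M) (msel t)) Ft)) := by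
  refine hcon_win₂ Φ hC hUdef hU hTrim hRL hL hLR fun x hx hnear hdeep t _ hin => ?_
  obtain ⟨ℓ, hℓ, hMℓ, hψ, hroomD, a, τ, hroomT⟩ := hroom x hx hnear
  have hballR : graphBall G (cubeCtr Φ (deepCtr Φ w₀ R (lo - (j : Site 2)) (hi + (j : Site 2)) ℓs M x) (exitDir Φ w₀ R (lo - (j : Site 2)) (hi + (j : Site 2)) x).1 (exitDir Φ w₀ R (lo - (j : Site 2)) (hi + (j : Site 2)) x).2 ℓs M) (fatRadius Φ hC ℓ) ⊆ graphBall G w₀ R :=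
    ((graphBall_mono G _ hψ).trans hdeep).trans (graphBall_mono G w₀ hRtR)
  have hballRt : graphBall G (cubeCtr Φ (deepCtr Φ w₀ R (lo - (j : Site 2)) (hi + (j : Site 2)) ℓs M x) (exitDir Φ w₀ R (lo - (j : Site 2)) (hi + (j : Site 2)) x).1 (exitDir Φ w₀ R (lo - (j : Site 2)) (hi + (j : Site 2)) x).2 ℓs M) (fatRadius Φ hC ℓ) ⊆ graphBall G w₀ Rt := (graphBall_mono G _ hψ).trans hdeep
  have hQD : fatSeq Φ hC (cubeCtr Φ (deepCtr Φ w₀ R (lo - (j : Site 2)) (hi + (j : Site 2)) ℓs M x) (exitDir Φ w₀ R (lo - (j : Site 2)) (hi + (j : Site 2)) x).1 (exitDir Φ w₀ R (lo - (j : Site 2)) (hi + (j : Site 2)) x).2 ℓs M) ℓ ⊆ D :=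
    (Skel.fatSeq_subset_Win Φ hC hballR fun y hy => hroomD _ (by rwa [add_sub_cancel_left])).trans hDpl
  have hQ : ∀ u ∈ fatSeq Φ hC (cubeCtr Φ (deepCtr Φ w₀ R (lo - (j : Site 2)) (hi + (j : Site 2)) ℓs M x) (exitDir Φ w₀ R (lo - (j : Site 2)) (hi + (j : Site 2)) x).1 (exitDir Φ w₀ R (lo - (j : Site 2)) (hi + (j : Site 2)) x).2 ℓs M) ℓ, ∀ v ∈ fatSeq Φ hC (cubeCtr Φ (deepCtr Φ w₀ R (lo - (j : Site 2)) (hi + (j : Site 2)) ℓs M x) (exitDir Φ w₀ R (lo - (j : Site 2)) (hi + (j : Site 2)) x).1 (exitDir Φ w₀ R (lo - (j : Site 2)) (hi + (j : Site 2)) x).2 ℓs M) ℓ, G.Adj u v → (winGraph G w₀ R).Adj u v :=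
    Skel.adj_winGraph_of_subset_graphBall fun u hu => hballR (mem_graphBall_of_mem_fatSeq Φ hC hu)
  have hT : macroPiece Φ (cubeCtr Φ (deepCtr Φ w₀ R (lo - (j : Site 2)) (hi + (j : Site 2)) ℓs M x) (exitDir Φ w₀ R (lo - (j : Site 2)) (hi + (j : Site 2)) x).1 (exitDir Φ w₀ R (lo - (j : Site 2)) (hi + (j : Site 2)) x).2 ℓs M) ℓ (fatRadius Φ hC ℓ) (faceElt a τ) ⊆ T :=
    (Skel.macroPiece_faceElt_subset_Win Φ hballRt hroomT).trans hTpl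
  have hin' : ∀ M' ∈ Ssc, 1 - δ ^ 2 < (bondPercolation G q).real (UniqZone.zone G (fatSeq Φ hC (cubeCtr Φ (deepCtr Φ w₀ R (lo - (j : Site 2)) (hi + (j : Site 2)) ℓs M x) (exitDir Φ w₀ R (lo - (j : Site 2)) (hi + (j : Site 2)) x).1 (exitDir Φ w₀ R (lo - (j : Site 2)) (hi + (j : Site 2)) x).2 ℓs M)) (msel t) M') ∧
      ∀ g' : HOct 2, 1 - δ ^ 2 < (bondPercolation G q).real
        (linkIn (↑(fatSeq Φ hC (cubeCtr Φ (deepCtr Φ w₀ R (lo - (j : Site 2)) (hi + (j : Site 2)) ℓs M x) (exitDir Φ w₀ R (lo - (j : Site 2)) (hi + (j : Site 2)) x).1 (exitDir Φ w₀ R (lo - (j : Site 2)) (hi + (j : Site 2)) x).2 ℓs M) M')) (fatSeq Φ hC (cubeCtr Φ (deepCtr Φ w₀ R (lo - (j : Site 2)) (hi + (j : Site 2)) ℓs M x) (exitDir Φ w₀ R (lo - (j : Site 2)) (hi + (j : Site 2)) x).1 (exitDir Φ w₀ R (lo - (j : Site 2)) (hi + (j : Site 2)) x).2 ℓs M) (msel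 t)) (macroPiece Φ (cubeCtr Φ (deepCtr Φ w₀ R (lo - (j : Site 2)) (hi + (j : Site 2)) ℓs M x) (exitDir Φ w₀ R (lo - (j : Site 2)) (hi + (j : Site 2)) x).1 (exitDir Φ w₀ R (lo - (j : Site 2)) (hi + (j : Site 2)) x).2 ℓs M) M' (fatRadius Φ hC M') g')) := hin
  exact Skel.hcon_of_straight Φ hC (winGraph_le G w₀ R) hWD hℓ hMℓ hQD hQ hT hin'


/-! ## §4 Variants with a free input margin in the guard -/

/-- **The per-contact dichotomy `hcon` of `SkelI.kitClause` for a window step with true target + rim, deep contacts by an abstract ROUTE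
hypothesis under deepness.**  Hypotheses: the near face map `Unear` IS the cube face at near contacts (`hUdef`, as in `kitClause`) and satisfies the near-face
conditions (`NearFaceOKDeep`, e.g. p3-g4's `nearFaceOK_cube`) for `U x ⊆ B⟨j⟩`; every
level vertex beyond depth `Rt − L''` is in the target (`hTrim`); far contacts are rim contacts (`Rt − L'' ≤ R − r₀`); the deepness radius and
the cube reach fit in the rim width (`Ldeep + ψ M ≤ L'' ≤ Rt`); and for DEEP near contacts (`B_G(c x, Ldeep) ⊆ B_G(w₀, Rt)`) the route clause.
Variant with a free INPUT MARGIN `am` in the guard of the route branch (the face step's inner chain needs its first-hop link input finer than `δ²`).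
[cite: KozmaNitzan2024, §4 Lemma 10 Step IV (pp. 19–21), Lemma 11 (p. 22), Lemma 12 (p. 24)] -/
theorem hcon_win₂' {am : ℝ} (hUdef : ∀ x ∈ outerBoundary (winGraph G w₀ R) (winLevel Φ w₀ R lo hi j),
      (inNbr Φ w₀ R (Finset.Icc (lo - (j : Site 2)) (hi + (j : Site 2))) x) ∈ graphBall G w₀ (R - r₀) →
      Unear x = (cubeFace Φ hC (deepCtr Φ w₀ R (lo - (j : Site 2)) (hi + (j : Site 2)) ℓs M x) (exitDir Φ w₀ R (lo - (j : Site 2)) (hi + (j : Site 2)) x).1 (exitDir Φ w₀ R (lo - (j : Site 2)) (hi + (j : Site 2)) x).2 ℓs M))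
    (hU : NearFaceOKDeep Φ w₀ R lo hi j ℓs M R' r₀ rs cU Unear)
    (hTrim : ∀ v ∈ winLevel Φ w₀ R lo hi j, v ∉ graphBall G w₀ (Rt - L'') → v ∈ T) (hRL : Rt - L'' ≤ R - r₀)
    (hL : Ldeep + fatRadius Φ hC M ≤ L'') (hLR : L'' ≤ Rt)
    (hroute : ∀ x ∈ outerBoundary (winGraph G w₀ R) (winLevel Φ w₀ R lo hi j),
      (inNbr Φ w₀ R (Finset.Icc (lo - (j : Site 2)) (hi + (j : Site 2))) x) ∈ graphBall G w₀ (R - r₀) →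
      graphBall G (cubeCtr Φ (deepCtr Φ w₀ R (lo - (j : Site 2)) (hi + (j : Site 2)) ℓs M x) (exitDir Φ w₀ R (lo - (j : Site 2)) (hi + (j : Site 2)) x).1 (exitDir Φ w₀ R (lo - (j : Site 2)) (hi + (j : Site 2)) x).2 ℓs M) Ldeep ⊆ graphBall G w₀ Rt →
      ∀ t ∈ Φ.types,
        (∀ M' ∈ Ssc, 1 - am < (bondPercolation G q).real (UniqZone.zone G (fatSeq Φ hC (cubeCtr Φ (deepCtr Φ w₀ R (lo - (j : Site 2)) (hi + (j : Site 2)) ℓs M x) (exitDir Φ w₀ R (lo - (j : Site 2)) (hi + (j : Site 2)) x).1 (exitDir Φ w₀ R (lo - (j : Site 2)) (hi + (j : Site 2)) x).2 ℓs M)) (msel t) M') ∧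
          ∀ g' : HOct 2, 1 - am < (bondPercolation G q).real
            (linkIn (↑(fatSeq Φ hC (cubeCtr Φ (deepCtr Φ w₀ R (lo - (j : Site 2)) (hi + (j : Site 2)) ℓs M x) (exitDir Φ w₀ R (lo - (j : Site 2)) (hi + (j : Site 2)) x).1 (exitDir Φ w₀ R (lo - (j : Site 2)) (hi + (j : Site 2)) x).2 ℓs M) M')) (fatSeq Φ hC (cubeCtr Φ (deepCtr Φ w₀ R (lo - (j : Site 2)) (hi + (j : Site 2)) ℓs M x) (exitDir Φ w₀ R (lo - (j : Site 2)) (hi + (j : Site 2)) x).1 (exitDir Φ w₀ R (lo - (j : Site 2)) (hi + (j : Site 2)) x).2 ℓs M) (msel t)) (macroPiece Φ (cubeCtr Φ (deepCtr Φ w₀ R (lo - (j : Site 2)) (hi + (j : Site 2)) ℓs M x) (exitDir Φ w₀ R (lo - (j : Site 2)) (hi + (j : Site 2)) x).1 (exitDir Φ w₀ R (lo - (j : Site 2)) (hi + (j : Site 2)) x).2 ℓs M) M' (fatRadius Φ hC M') g'))) →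
        ∃ Qt Ft : Finset V, Ft ⊆ T ∧ Qt ⊆ D ∧ (∀ u ∈ Qt, ∀ v ∈ Qt, G.Adj u v → (winGraph G w₀ R).Adj u v) ∧
          Disjoint Ft (fatSeq Φ hC (cubeCtr Φ (deepCtr Φ w₀ R (lo - (j : Site 2)) (hi + (j : Site 2)) ℓs M x) (exitDir Φ w₀ R (lo - (j : Site 2)) (hi + (j : Site 2)) x).1 (exitDir Φ w₀ R (lo - (j : Site 2)) (hi + (j : Site 2)) x).2 ℓs M) M) ∧
          1 - δ ^ 2 < (prodBernoulli Wt).real (linkIn (↑Qt) (fatSeq Φ hC (cubeCtr Φ (deepCtr Φ w₀ R (lo - (j : Site 2)) (hi + (j : Site 2)) ℓs M x) (exitDir Φ w₀ R (lo - (j : Site 2)) (hi + (j : Site 2)) x).1 (exitDir Φ w₀ R (lo - (j : Site 2)) (hi + (j : Site 2)) x).2 ℓs M) (msel t)) Ft)) :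
    ∀ x ∈ outerBoundary (winGraph G w₀ R) (winLevel Φ w₀ R lo hi j),
      (∃ u ∈ (slabGeomDeep Φ w₀ R lo hi j ℓs M R' r₀ Unear).U x, u ∈ T) ∨
      ((inNbr Φ w₀ R (Finset.Icc (lo - (j : Site 2)) (hi + (j : Site 2))) x) ∈ graphBall G w₀ (R - r₀) ∧ ∀ t ∈ Φ.types,
        (∀ M' ∈ Ssc, 1 - am < (bondPercolation G q).real (UniqZone.zone G (fatSeq Φ hC (cubeCtr Φ (deepCtr Φ w₀ R (lo - (j : Site 2)) (hi + (j : Site 2)) ℓs M x) (exitDir Φ w₀ R (lo - (j : Site 2)) (hi + (j : Site 2)) x).1 (exitDir Φ w₀ R (lo - (j : Site 2)) (hi + (j : Site 2)) x).2 ℓs M)) (msel t) M') ∧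
          ∀ g' : HOct 2, 1 - am < (bondPercolation G q).real
            (linkIn (↑(fatSeq Φ hC (cubeCtr Φ (deepCtr Φ w₀ R (lo - (j : Site 2)) (hi + (j : Site 2)) ℓs M x) (exitDir Φ w₀ R (lo - (j : Site 2)) (hi + (j : Site 2)) x).1 (exitDir Φ w₀ R (lo - (j : Site 2)) (hi + (j : Site 2)) x).2 ℓs M) M')) (fatSeq Φ hC (cubeCtr Φ (deepCtr Φ w₀ R (lo - (j : Site 2)) (hi + (j : Site 2)) ℓs M x) (exitDir Φ w₀ R (lo - (j : Site 2)) (hi + (j : Site 2)) x).1 (exitDir Φ w₀ R (lo - (j : Site 2)) (hi + (j : Site 2)) x).2 ℓs M) (msel t)) (macroPiece Φ (cubeCtr Φ (deepCtr Φ w₀ R (lo - (j : Site 2)) (hi + (j : Site 2)) ℓs M x) (exitDir Φ w₀ R (lo - (j : Site 2)) (hi + (j : Site 2)) x).1 (exitDir Φ w₀ R (lo - (j : Site 2)) (hi + (j : Site 2)) x).2 ℓs M) M' (fatRadius Φ hC M') g'))) →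
        ∃ Qt Ft : Finset V, Ft ⊆ T ∧ Qt ⊆ D ∧ (∀ u ∈ Qt, ∀ v ∈ Qt, G.Adj u v → (winGraph G w₀ R).Adj u v) ∧
          Disjoint Ft (fatSeq Φ hC (cubeCtr Φ (deepCtr Φ w₀ R (lo - (j : Site 2)) (hi + (j : Site 2)) ℓs M x) (exitDir Φ w₀ R (lo - (j : Site 2)) (hi + (j : Site 2)) x).1 (exitDir Φ w₀ R (lo - (j : Site 2)) (hi + (j : Site 2)) x).2 ℓs M) M) ∧
          1 - δ ^ 2 < (prodBernoulli Wt).real (linkIn (↑Qt) (fatSeq Φ hC (cubeCtr Φ (deepCtr Φ w₀ R (lo - (j : Site 2)) (hi + (j : Site 2)) ℓs M x) (exitDir Φ w₀ R (lo - (j : Site 2)) (hi + (j : Site 2)) x).1 (exitDir Φ w₀ R (lo - (j : Site 2)) (hi + (j : Site 2)) x).2 ℓs M) (msel t)) Ft)) := by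
  intro x hx
  by_cases hnear : (inNbr Φ w₀ R (Finset.Icc (lo - (j : Site 2)) (hi + (j : Site 2))) x) ∈ graphBall G w₀ (R - r₀)
  · by_cases hdeep : graphBall G (cubeCtr Φ (deepCtr Φ w₀ R (lo - (j : Site 2)) (hi + (j : Site 2)) ℓs M x) (exitDir Φ w₀ R (lo - (j : Site 2)) (hi + (j : Site 2)) x).1 (exitDir Φ w₀ R (lo - (j : Site 2)) (hi + (j : Site 2)) x).2 ℓs M) Ldeep ⊆ graphBall G w₀ Rt
    · exact Or.inr ⟨hnear, fun t ht hin => hroute x hx hnear hdeep t ht hin⟩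
    · -- near but not deep: the whole cube face lies in the rim
      left
      obtain ⟨u, hu⟩ := cubeFace_nonempty Φ hC (deepCtr Φ w₀ R (lo - (j : Site 2)) (hi + (j : Site 2)) ℓs M x) (exitDir Φ w₀ R (lo - (j : Site 2)) (hi + (j : Site 2)) x).1 (exitDir Φ w₀ R (lo - (j : Site 2)) (hi + (j : Site 2)) x).2 ℓs M
      have hUx : (slabGeomDeep Φ w₀ R lo hi j ℓs M R' r₀ Unear).U x = Unear x := by
        simp only [slabGeomDeep, if_pos hnear]
      have hu' : u ∈ Unear x := by rw [hUdef x hx hnear]; exact hu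
      refine ⟨u, by rw [hUx]; exact hu', hTrim u (hU.sub x hx hnear hu') fun hub => ?_⟩
      rcases Skel.deep_or_far G (cubeCtr Φ (deepCtr Φ w₀ R (lo - (j : Site 2)) (hi + (j : Site 2)) ℓs M x) (exitDir Φ w₀ R (lo - (j : Site 2)) (hi + (j : Site 2)) x).1 (exitDir Φ w₀ R (lo - (j : Site 2)) (hi + (j : Site 2)) x).2 ℓs M) hL hLR with h | h
      · exact hdeep h
      · exact Set.disjoint_left.1 h (mem_graphBall_of_mem_fatSeq Φ hC (cubeFace_subset_fatSeq Φ hC _ _ _ _ _ hu)) hub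
  · -- far contact: its inner neighbour is a rim vertex
    left
    have hy := inNbr_spec Φ (P := Finset.Icc (lo - (j : Site 2)) (hi + (j : Site 2))) hx
    have hUx : (slabGeomDeep Φ w₀ R lo hi j ℓs M R' r₀ Unear).U x = {(inNbr Φ w₀ R (Finset.Icc (lo - (j : Site 2)) (hi + (j : Site 2))) x)} := by
      simp only [slabGeomDeep, if_neg hnear]
    refine ⟨(inNbr Φ w₀ R (Finset.Icc (lo - (j : Site 2)) (hi + (j : Site 2))) x), by rw [hUx]; exact Finset.mem_singleton_self _, hTrim _ ?_ fun hyb => hnear (graphBall_mono G w₀ hRL hyb)⟩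
    rw [mem_winLevel_iff]
    exact ⟨hy.2.1, hy.2.2⟩


/-- **The per-contact dichotomy `hcon` for a window step with true target + rim and STRAIGHT deep routes** (corridor / root / inner steps):
for every near contact a route scale `ℓ ∈ Ssc`, `M < ℓ`, `ψ ℓ ≤ Ldeep`, with the planar square `φ(c x) + Λ_ℓ` inside `Dpl` and a quarter face
`φ(c x) + F_{a,τ}(ℓ)` inside `Tpl` (`hroom`), where `D ⊇ Win w₀ Dpl R` and `T ⊇ Win w₀ Tpl Rt`. [cite: KozmaNitzan2024, §4 Lemma 10 Step IV (p. 20), Lemma 11 (p. 23)]  Variant with input margin `am ≤ δ²` in the guard. -/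
theorem hcon_win₂_of_room' {am : ℝ} (ha : am ≤ δ ^ 2) (hUdef : ∀ x ∈ outerBoundary (winGraph G w₀ R) (winLevel Φ w₀ R lo hi j),
      (inNbr Φ w₀ R (Finset.Icc (lo - (j : Site 2)) (hi + (j : Site 2))) x) ∈ graphBall G w₀ (R - r₀) →
      Unear x = (cubeFace Φ hC (deepCtr Φ w₀ R (lo - (j : Site 2)) (hi + (j : Site 2)) ℓs M x) (exitDir Φ w₀ R (lo - (j : Site 2)) (hi + (j : Site 2)) x).1 (exitDir Φ w₀ R (lo - (j : Site 2)) (hi + (j : Site 2)) x).2 ℓs M))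
    (hU : NearFaceOKDeep Φ w₀ R lo hi j ℓs M R' r₀ rs cU Unear)
    (hTrim : ∀ v ∈ winLevel Φ w₀ R lo hi j, v ∉ graphBall G w₀ (Rt - L'') → v ∈ T) (hRL : Rt - L'' ≤ R - r₀)
    (hL : Ldeep + fatRadius Φ hC M ≤ L'') (hLR : L'' ≤ Rt) (hRtR : Rt ≤ R)
    (hWD : IsSubbox (winGraph G w₀ R) Wt q D) {Dpl Tpl : Finset (Site 2)} (hDpl : Φ.Win w₀ Dpl R ⊆ D) (hTpl : Φ.Win w₀ Tpl Rt ⊆ T)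
    (hroom : ∀ x ∈ outerBoundary (winGraph G w₀ R) (winLevel Φ w₀ R lo hi j),
      (inNbr Φ w₀ R (Finset.Icc (lo - (j : Site 2)) (hi + (j : Site 2))) x) ∈ graphBall G w₀ (R - r₀) →
      ∃ ℓ ∈ Ssc, M < ℓ ∧ fatRadius Φ hC ℓ ≤ Ldeep ∧
        (∀ z : Site 2, z - Φ.φ (cubeCtr Φ (deepCtr Φ w₀ R (lo - (j : Site 2)) (hi + (j : Site 2)) ℓs M x) (exitDir Φ w₀ R (lo - (j : Site 2)) (hi + (j : Site 2)) x).1 (exitDir Φ w₀ R (lo - (j : Site 2)) (hi + (j : Site 2)) x).2 ℓs M) ∈ box 2 ℓ → z ∈ Dpl) ∧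
        ∃ (a : Fin 2) (τ : ℤˣ), ∀ z : Site 2, z a = Φ.φ (cubeCtr Φ (deepCtr Φ w₀ R (lo - (j : Site 2)) (hi + (j : Site 2)) ℓs M x) (exitDir Φ w₀ R (lo - (j : Site 2)) (hi + (j : Site 2)) x).1 (exitDir Φ w₀ R (lo - (j : Site 2)) (hi + (j : Site 2)) x).2 ℓs M) a + (τ : ℤ) * ℓ →
          Φ.φ (cubeCtr Φ (deepCtr Φ w₀ R (lo - (j : Site 2)) (hi + (j : Site 2)) ℓs M x) (exitDir Φ w₀ R (lo - (j : Site 2)) (hi + (j : Site 2)) x).1 (exitDir Φ w₀ R (lo - (j : Site 2)) (hi + (j : Site 2)) x).2 ℓs M) (oth a) ≤ z (oth a) → z (oth a) ≤ Φ.φ (cubeCtr Φ (deepCtr Φ w₀ R (lo - (j : Site 2)) (hi + (j : Site 2)) ℓs M x) (exitDir Φ w₀ R (lo - (j : Site 2)) (hi + (j : Site 2)) x).1 (exitDir Φ w₀ R (lo - (j : Site 2)) (hi + (j : Site 2)) x).2 ℓs M) (oth a) + ℓ → z ∈ Tpl) :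
    ∀ x ∈ outerBoundary (winGraph G w₀ R) (winLevel Φ w₀ R lo hi j),
      (∃ u ∈ (slabGeomDeep Φ w₀ R lo hi j ℓs M R' r₀ Unear).U x, u ∈ T) ∨
      ((inNbr Φ w₀ R (Finset.Icc (lo - (j : Site 2)) (hi + (j : Site 2))) x) ∈ graphBall G w₀ (R - r₀) ∧ ∀ t ∈ Φ.types,
        (∀ M' ∈ Ssc, 1 - am < (bondPercolation G q).real (UniqZone.zone G (fatSeq Φ hC (cubeCtr Φ (deepCtr Φ w₀ R (lo - (j : Site 2)) (hi + (j : Site 2)) ℓs M x) (exitDir Φ w₀ R (lo - (j : Site 2)) (hi + (j : Site 2)) x).1 (exitDir Φ w₀ R (lo - (j : Site 2)) (hi + (j : Site 2)) x).2 ℓs M)) (msel t) M') ∧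
          ∀ g' : HOct 2, 1 - am < (bondPercolation G q).real
            (linkIn (↑(fatSeq Φ hC (cubeCtr Φ (deepCtr Φ w₀ R (lo - (j : Site 2)) (hi + (j : Site 2)) ℓs M x) (exitDir Φ w₀ R (lo - (j : Site 2)) (hi + (j : Site 2)) x).1 (exitDir Φ w₀ R (lo - (j : Site 2)) (hi + (j : Site 2)) x).2 ℓs M) M')) (fatSeq Φ hC (cubeCtr Φ (deepCtr Φ w₀ R (lo - (j : Site 2)) (hi + (j : Site 2)) ℓs M x) (exitDir Φ w₀ R (lo - (j : Site 2)) (hi + (j : Site 2)) x).1 (exitDir Φ w₀ R (lo - (j : Site 2)) (hi + (j : Site 2)) x).2 ℓs M) (msel t)) (macroPiece Φ (cubeCtr Φ (deepCtr Φ w₀ R (lo - (j : Site 2)) (hi + (j : Site 2)) ℓs M x) (exitDir Φ w₀ R (lo - (j : Site 2)) (hi + (j : Site 2)) x).1 (exitDir Φ w₀ R (lo - (j : Site 2)) (hi + (j : Site 2)) x).2 ℓs M) M' (fatRadius Φ hC M') g'))) →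
        ∃ Qt Ft : Finset V, Ft ⊆ T ∧ Qt ⊆ D ∧ (∀ u ∈ Qt, ∀ v ∈ Qt, G.Adj u v → (winGraph G w₀ R).Adj u v) ∧
          Disjoint Ft (fatSeq Φ hC (cubeCtr Φ (deepCtr Φ w₀ R (lo - (j : Site 2)) (hi + (j : Site 2)) ℓs M x) (exitDir Φ w₀ R (lo - (j : Site 2)) (hi + (j : Site 2)) x).1 (exitDir Φ w₀ R (lo - (j : Site 2)) (hi + (j : Site 2)) x).2 ℓs M) M) ∧
          1 - δ ^ 2 < (prodBernoulli Wt).real (linkIn (↑Qt) (fatSeq Φ hC (cubeCtr Φ (deepCtr Φ w₀ R (lo - (j : Site 2)) (hi + (j : Site 2)) ℓs M x) (exitDir Φ w₀ R (lo - (j : Site 2)) (hi + (j : Site 2)) x).1 (exitDir Φ w₀ R (lo - (j : Site 2)) (hi + (j : Site 2)) x).2 ℓs M) (msel t)) Ft)) := by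
  refine hcon_win₂' Φ hC hUdef hU hTrim hRL hL hLR fun x hx hnear hdeep t _ hin => ?_
  obtain ⟨ℓ, hℓ, hMℓ, hψ, hroomD, a, τ, hroomT⟩ := hroom x hx hnear
  have hballR : graphBall G (cubeCtr Φ (deepCtr Φ w₀ R (lo - (j : Site 2)) (hi + (j : Site 2)) ℓs M x) (exitDir Φ w₀ R (lo - (j : Site 2)) (hi + (j : Site 2)) x).1 (exitDir Φ w₀ R (lo - (j : Site 2)) (hi + (j : Site 2)) x).2 ℓs M) (fatRadius Φ hC ℓ) ⊆ graphBall G w₀ R :=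
    ((graphBall_mono G _ hψ).trans hdeep).trans (graphBall_mono G w₀ hRtR)
  have hballRt : graphBall G (cubeCtr Φ (deepCtr Φ w₀ R (lo - (j : Site 2)) (hi + (j : Site 2)) ℓs M x) (exitDir Φ w₀ R (lo - (j : Site 2)) (hi + (j : Site 2)) x).1 (exitDir Φ w₀ R (lo - (j : Site 2)) (hi + (j : Site 2)) x).2 ℓs M) (fatRadius Φ hC ℓ) ⊆ graphBall G w₀ Rt := (graphBall_mono G _ hψ).trans hdeep
  have hQD : fatSeq Φ hC (cubeCtr Φ (deepCtr Φ w₀ R (lo - (j : Site 2)) (hi + (j : Site 2)) ℓs M x) (exitDir Φ w₀ R (lo - (j : Site 2)) (hi + (j : Site 2)) x).1 (exitDir Φ w₀ R (lo - (j : Site 2)) (hi + (j : Site 2)) x).2 ℓs M) ℓ ⊆ D :=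
    (Skel.fatSeq_subset_Win Φ hC hballR fun y hy => hroomD _ (by rwa [add_sub_cancel_left])).trans hDpl
  have hQ : ∀ u ∈ fatSeq Φ hC (cubeCtr Φ (deepCtr Φ w₀ R (lo - (j : Site 2)) (hi + (j : Site 2)) ℓs M x) (exitDir Φ w₀ R (lo - (j : Site 2)) (hi + (j : Site 2)) x).1 (exitDir Φ w₀ R (lo - (j : Site 2)) (hi + (j : Site 2)) x).2 ℓs M) ℓ, ∀ v ∈ fatSeq Φ hC (cubeCtr Φ (deepCtr Φ w₀ R (lo - (j : Site 2)) (hi + (j : Site 2)) ℓs M x) (exitDir Φ w₀ R (lo - (j : Site 2)) (hi + (j : Site 2)) x).1 (exitDir Φ w₀ R (lo - (j : Site 2)) (hi + (j : Site 2)) x).2 ℓs M) ℓ, G.Adj u v → (winGraph G w₀ R).Adj u v :=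
    Skel.adj_winGraph_of_subset_graphBall fun u hu => hballR (mem_graphBall_of_mem_fatSeq Φ hC hu)
  have hT : macroPiece Φ (cubeCtr Φ (deepCtr Φ w₀ R (lo - (j : Site 2)) (hi + (j : Site 2)) ℓs M x) (exitDir Φ w₀ R (lo - (j : Site 2)) (hi + (j : Site 2)) x).1 (exitDir Φ w₀ R (lo - (j : Site 2)) (hi + (j : Site 2)) x).2 ℓs M) ℓ (fatRadius Φ hC ℓ) (faceElt a τ) ⊆ T :=
    (Skel.macroPiece_faceElt_subset_Win Φ hballRt hroomT).trans hTpl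
  have hin' : ∀ M' ∈ Ssc, 1 - am < (bondPercolation G q).real (UniqZone.zone G (fatSeq Φ hC (cubeCtr Φ (deepCtr Φ w₀ R (lo - (j : Site 2)) (hi + (j : Site 2)) ℓs M x) (exitDir Φ w₀ R (lo - (j : Site 2)) (hi + (j : Site 2)) x).1 (exitDir Φ w₀ R (lo - (j : Site 2)) (hi + (j : Site 2)) x).2 ℓs M)) (msel t) M') ∧
      ∀ g' : HOct 2, 1 - am < (bondPercolation G q).real
        (linkIn (↑(fatSeq Φ hC (cubeCtr Φ (deepCtr Φ w₀ R (lo - (j : Site 2)) (hi + (j : Site 2)) ℓs M x) (exitDir Φ w₀ R (lo - (j : Site 2)) (hi + (j : Site 2)) x).1 (exitDir Φ w₀ R (lo - (j : Site 2)) (hi + (j : Site 2)) x).2 ℓs M) M')) (fatSeq Φ hC (cubeCtr Φ (deepCtr Φ w₀ R (lo - (j : Site 2)) (hi + (j : Site 2)) ℓs M x) (exitDir Φ w₀ R (lo - (j : Site 2)) (hi + (j : Site 2)) x).1 (exitDir Φ w₀ R (lo - (j : Site 2)) (hi + (j : Site 2)) x).2 ℓs M) (msel t)) (macroPiece Φ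 (cubeCtr Φ (deepCtr Φ w₀ R (lo - (j : Site 2)) (hi + (j : Site 2)) ℓs M x) (exitDir Φ w₀ R (lo - (j : Site 2)) (hi + (j : Site 2)) x).1 (exitDir Φ w₀ R (lo - (j : Site 2)) (hi + (j : Site 2)) x).2 ℓs M) M' (fatRadius Φ hC M') g')) := hin
  obtain ⟨Qt, Ft, h1, h2, h3, h4, h5⟩ := Skel.hcon_of_straight Φ hC (winGraph_le G w₀ R) hWD hℓ hMℓ hQD hQ hT hin'
  exact ⟨Qt, Ft, h1, h2, h3, h4, (sub_le_sub_left ha 1).trans_lt h5⟩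

end Dichotomy

end SkelI

end Transplant

end Summit.CriticalPhenomena.PercolationContinuityZ3.Theorems

end
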